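/-
Copyright (c) 2026 the pub-hodgecm-mathlib formalisation cell (harness21).  Prover seat hodgecm-mathlib-LH4-p04 (g5), Track A «(D-RAM) FOUR-FRAME», unit U2H, the census leaf
(ρ2b′-X) `stub_U2H_fixedPointCensus_typeTwo_unit0` — socket (C) (type RamM bottom, dealer WORD #30: lead LH4-p04 + LH4-p06), organ (C-0) «FRAME-RM LETTERS»: the one-field
algebra the RamM bottom needs before any count — DEFS congruence under a change of generator (socket generator `α` ↦ datum uniformiser).  2026-09-04.
-/
import Summits.HodgeConjecture.HodgeConjecture.Theorems.F0P3cDyRamToricCensusDefs            -- ★ p857239 (LH4-p12 (g4)): `IsOrd ∕ dualGen ∕ levelSet ∕ levelSetDep`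
import Literature.NumberTheory.LocalFields.QuadraticOrderNormDepthIndexTwoRamified           -- ★ p857465 (LH4-p06 (g4)): `v_sub_map_le_pow_of_v_le_one` (the different bound `|z − σz| ≤ |π|^d` on integral `z`)
import Literature.NumberTheory.Automorphic.UnitaryThreeFourFrameDefs                        -- D `IsRamifiedQuadraticDatum`
import HarnessLib

/-!
# F0 · P3c · line LH4 «(D-RAM) FOUR-FRAME» — unit (ii-H), leaf (ρ2b′-X), socket (C) (type RamM), organ (C-0): FRAME-RM LETTERS
# (Serre 1979 Ch. III §6; Jacobowitz 1962 §4)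

Cell `pub/hodgecm-mathlib` (D-0151), crux H413 = `stmt-HodgeConjecture-24833` (helper lane `--supports stmt-HodgeConjecture-24833 --as helper`, count-neutral); THEOREMS ONLY (no
definition, no instance, no notation, no named fact, no `sorry`, default heartbeats).  Socket served: the typed order-count socket (C) `SOCKET-hOCC.v1` 869d0c15 (payer LH4-p14 (g4),
MAP v3) — the RamM bottom `orderCountCensusC` (head sheet `F0/P3c/LH4/LH4-p04/g5/socketC/HEAD.C.v1`), organ (C-0) of the lead's architecture (LINE #1 2026-09-04T06:39Z).

ONE valued field `K` (= the completed line `M = E′_{w₁}`), commuting involutions `ρ` (= `Gal(M∕L_w)`), `Θ` (extending `σ_w`), `τ := Θ∘ρ`.  The fact the RamM bottom needs BEFORE the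
★ T5c heads (LH4-p06) can be quoted at the socket's letters:

* §1 **DEFS CONGRUENCE UNDER A CHANGE OF GENERATOR.**  The ★ DEFS currency reads the generator `α` of `𝒪_M` over `𝒪_E` ONLY through `α − ρα` (`IsOrd ρ α c z ↔ |z| ≤ 1 ∧ |z − ρz| ≤
  |c(α − ρα)|`; `dualGen = h·x₀Θx₀·c·(α − ρα)`).  Hence for two generators with `|α − ρα| = |α′ − ρα′|` and scalars with `h·(α − ρα) = h′·(α′ − ρα′)`:
  **`levelSet ρ Θ α ϖE h = levelSet ρ Θ α′ ϖE h′`** (`levelSet_eq_of_mul_sub_map_eq`) and, when `h′ = h·e` with `e` a `ρ`-FIXED UNIT and `α − ρα = e·(α′ − ρα′)`,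
  **`levelSetDep ρ Θ α ϖE h = levelSetDep ρ Θ α′ ϖE h′`** (`levelSetDep_eq_of_twist`; the depth pairing `Tr(h·Θx·b)` is multiplied by the `ρ`-fixed unit `e`).  The socket's `α`
  (an `𝒪_E`-generator: `hint`, `|α| ≤ 1`, `ρα ≠ α`, type letter `|α − ρα| < 1`) is NOT a uniformiser of `M` in general, while the ★ T5c heads bind `IsRamifiedQuadraticDatum ρ ϖM d_ρ t`
  with `ϖM` a uniformiser: **`exists_twist_of_generator`** supplies, for any such datum `ϖM`, the `ρ`-fixed unit `e := (α − ρα)∕(ϖM − ρϖM)` (`|ϖM − ρϖM| ≤ |α − ρα|` by `hint` at `z = ϖM`;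
  `|α − ρα| ≤ |ϖM|^{d_ρ} = |ϖM − ρϖM|` by the ★ different bound), so that every ★ T5c statement about `levelSet∕levelSetDep (ϖM, h·e)` is a statement about the socket's
  `levelSet∕levelSetDep (α, h)`; the scalar letters the heads use (`h ≠ 0`, `|h|`, the twist `ρh∕h`) are unchanged up to the harmless unit `e` (`ρ(he)∕(he) = ρh∕h`).
* (The companion (C-0)(o6) letter `dΘ + dτ = 2·d` — the T5s-RamM head's `g + s0` IS the E-datum's `d` — is ★-bound SEPARATELY: F0P3a-p01 (g34)
  `Theorems/F0P3cDyRamKleinDifferentLetters.lean` (`v_sub_mul_v_sub_eq`, `add_eq_two_mul`), typed concurrently; not restated here.)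
HONEST LABEL: HC_CM is proved only modulo the 7 printed citations (2 remaining named inputs: hLiu418 = stmt-HodgeConjecture-24832, h413 = stmt-HodgeConjecture-24833) until rung 0
closes; (ρ2b′-X) :418 is an OPEN prover target — this file is a helper (`--supports`), proofs only; nothing printed is asserted.

## References
* [Serre1979] J.-P. Serre, *Local Fields*, GTM 67 (1979): Ch. III §6 Prop. 12–13 (the different of a monogenic extension; orders of conductor `c`), Ch. IV §1 Prop. 3–4.
* [Jacobowitz1962] R. Jacobowitz, *Hermitian forms over local fields*, Amer. J. Math. 84 (1962), §4 (the lattices `x₀·𝒪_c` and their dual generators).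
* [Kottwitz1986BaseChangeUnits] R. E. Kottwitz, *Base change for unit elements of Hecke algebras*, Compositio Math. 60 (1986), §1 pp. 240–241.
-/

set_option autoImplicit false

noncomputable section

namespace Summit.HodgeConjecture.HodgeConjecture.Cruxes.H413.F0P3cDyRamFrameRamMLetters

open WithZero
open scoped Valued
open Literature.NumberTheory.Automorphic.UnitaryThreeFourFrame (IsRamifiedQuadraticDatum)
open Literature.NumberTheory.LocalFields.QuadraticOrder (v_sub_map_le_pow_of_v_le_one)
open Summit.HodgeConjecture.HodgeConjecture.Cruxes.H413.F0P3cDyRamToricCensusDefs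

variable {K : Type} [Field K] [Valued K ℤᵐ⁰] {ρ Θ : K →+* K}

/-! ## §1 DEFS congruence under a change of generator -/

/-- `IsOrd` reads `α` only through `|α − ρα|`. [cite: Serre1979, Ch. III §6 Prop. 12] -/
theorem isOrd_iff_isOrd_of_v_sub_map_eq {α α' : K} (hαα : Valued.v (α - ρ α) = Valued.v (α' - ρ α')) (c z : K) :
    IsOrd ρ α c z ↔ IsOrd ρ α' c z := by
  rw [isOrd_iff, isOrd_iff, map_mul, map_mul, hαα]

omit [Valued K ℤᵐ⁰] in
/-- `dualGen` reads `(α, h)` only through the product `h·(α − ρα)`. [cite: Jacobowitz1962, §4] -/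
theorem dualGen_eq_of_mul_sub_map_eq {α α' h h' : K} (hh : h * (α - ρ α) = h' * (α' - ρ α')) (c x₀ : K) :
    dualGen ρ Θ α c h x₀ = dualGen ρ Θ α' c h' x₀ := by
  rw [dualGen_def, dualGen_def]
  calc h * (x₀ * Θ x₀) * (c * (α - ρ α)) = x₀ * Θ x₀ * c * (h * (α - ρ α)) := by ring
    _ = x₀ * Θ x₀ * c * (h' * (α' - ρ α')) := by rw [hh]
    _ = h' * (x₀ * Θ x₀) * (c * (α' - ρ α')) := by ring

/-- **`levelSet` CONGRUENCE**: `|α − ρα| = |α′ − ρα′|` and `h·(α − ρα) = h′·(α′ − ρα′)` give `levelSet ρ Θ α ϖE h j a = levelSet ρ Θ α′ ϖE h′ j a`.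
[cite: Jacobowitz1962, §4] [cite: Kottwitz1986BaseChangeUnits, §1 pp. 240–241] -/
theorem levelSet_eq_of_mul_sub_map_eq {α α' h h' : K} (hαα : Valued.v (α - ρ α) = Valued.v (α' - ρ α'))
    (hh : h * (α - ρ α) = h' * (α' - ρ α')) (ϖE : K) (j a : ℕ) :
    levelSet ρ Θ α ϖE h j a = levelSet ρ Θ α' ϖE h' j a := by
  ext Λ
  simp only [mem_levelSet_iff, isOrd_iff_isOrd_of_v_sub_map_eq hαα, dualGen_eq_of_mul_sub_map_eq (Θ := Θ) hh]

/-- The depth pairing is insensitive to a `ρ`-fixed unit in the scalar: `|h·e·Θx·b + ρ(h·e·Θx·b)| = |h·Θx·b + ρ(h·Θx·b)|`. [cite: Jacobowitz1962, §4] -/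
theorem v_pairing_mul_unit {h e : K} (hρe : ρ e = e) (hve : Valued.v e = 1) (y b : K) :
    Valued.v (h * e * y * b + ρ (h * e * y * b)) = Valued.v (h * y * b + ρ (h * y * b)) := by
  have : h * e * y * b + ρ (h * e * y * b) = e * (h * y * b + ρ (h * y * b)) := by
    simp only [map_mul, hρe]; ring
  rw [this, map_mul, hve, one_mul]

/-- **`levelSetDep` CONGRUENCE UNDER A `ρ`-FIXED UNIT TWIST**: with `e` a `ρ`-fixed unit, `h′ = h·e` and `α − ρα = e·(α′ − ρα′)`:
`levelSetDep ρ Θ α ϖE h j a μ = levelSetDep ρ Θ α′ ϖE h′ j a μ` (the lattices, their dual generators AND the tube condition agree). [cite: Jacobowitz1962, §4]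
[cite: Kottwitz1986BaseChangeUnits, §1 pp. 240–241] -/
theorem levelSetDep_eq_of_twist {α α' h h' e : K} (hρe : ρ e = e) (hve : Valued.v e = 1) (hh : h' = h * e)
    (hαα : α - ρ α = e * (α' - ρ α')) (ϖE : K) (j a : ℕ) (μ : K) :
    levelSetDep ρ Θ α ϖE h j a μ = levelSetDep ρ Θ α' ϖE h' j a μ := by
  have hvαα : Valued.v (α - ρ α) = Valued.v (α' - ρ α') := by rw [hαα, map_mul, hve, one_mul]
  have hmul : h * (α - ρ α) = h' * (α' - ρ α') := by rw [hαα, hh]; ring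
  ext Λ
  rw [mem_levelSetDep_iff, mem_levelSetDep_iff, levelSet_eq_of_mul_sub_map_eq (Θ := Θ) hvαα hmul]
  refine and_congr_right fun _ => forall_congr' fun b => ?_
  refine imp_congr_left <| forall₂_congr fun x _ => ?_
  rw [hh, v_pairing_mul_unit (ρ := ρ) hρe hve (Θ x) b]

/-- **THE TWIST FROM THE SOCKET'S GENERATOR TO A DATUM UNIFORMISER.**  Let `(ρ, ϖM, d_ρ, t)` be a ★ ramified datum on `M` and `α` an integral `𝒪_E`-generator in the socket's sense
(`ρα ≠ α`, `|α| ≤ 1`, `∀ z, |z| ≤ 1 → |(z − ρz)∕(α − ρα)| ≤ 1`).  Then `e := (α − ρα)∕(ϖM − ρϖM)` is a `ρ`-FIXED UNIT with `α − ρα = e·(ϖM − ρϖM)` — so §1 applies with `h′ := h·e`.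
[cite: Serre1979, Ch. III §6 Prop. 12] [cite: Serre1979, Ch. IV §1 Prop. 3–4] -/
theorem exists_twist_of_generator {ϖM α : K} {dρ t : ℕ} (hD : IsRamifiedQuadraticDatum ρ ϖM dρ t) (hρα : ρ α ≠ α) (hα1 : Valued.v α ≤ 1)
    (hint : ∀ z : K, Valued.v z ≤ 1 → Valued.v ((z - ρ z) / (α - ρ α)) ≤ 1) :
    ∃ e : K, ρ e = e ∧ Valued.v e = 1 ∧ α - ρ α = e * (ϖM - ρ ϖM) := by
  obtain ⟨hρρ, hvρ, hϖM, hfix, hdd, -, -⟩ := id hD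
  have hϖM1 : Valued.v ϖM ≤ 1 := by rw [hϖM, ← exp_zero, exp_le_exp]; omega
  have hδϖM0 : ϖM - ρ ϖM ≠ 0 := by
    intro h0
    rw [h0, map_zero] at hdd
    exact (pow_ne_zero _ (by rw [hϖM]; exact exp_ne_zero)) hdd.symm
  have hδα0 : α - ρ α ≠ 0 := sub_ne_zero.2 (Ne.symm hρα)
  refine ⟨(α - ρ α) / (ϖM - ρ ϖM), ?_, ?_, ?_⟩
  · rw [map_div₀, map_sub, map_sub, hρρ, hρρ, ← neg_sub α, ← neg_sub ϖM, neg_div_neg_eq]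
  · -- `|ϖM − ρϖM| ≤ |α − ρα|` (hint at `z = ϖM`) and `|α − ρα| ≤ |ϖM|^{d_ρ} = |ϖM − ρϖM|` (★ different bound)
    have h1 : Valued.v (ϖM - ρ ϖM) ≤ Valued.v (α - ρ α) := by
      have := hint ϖM hϖM1
      rwa [map_div₀, div_le_one₀ (zero_lt_iff.2 ((Valuation.ne_zero_iff _).2 hδα0))] at this
    have h2 : Valued.v (α - ρ α) ≤ Valued.v (ϖM - ρ ϖM) := by
      rw [hdd]; exact v_sub_map_le_pow_of_v_le_one hρρ hfix hϖM hdd hα1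
    rw [map_div₀, le_antisymm h2 h1, div_self ((Valuation.ne_zero_iff _).2 hδϖM0)]
  · rw [div_mul_cancel₀ _ hδϖM0]

end Summit.HodgeConjecture.HodgeConjecture.Cruxes.H413.F0P3cDyRamFrameRamMLetters

end
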